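import Mathlib.GroupTheory.Index
import Mathlib.GroupTheory.OrderOfElement
import Mathlib.Data.ZMod.Basic
import Mathlib.GroupTheory.SpecificGroups.Cyclic
import Mathlib.Tactic.LinearCombination
import HarnessLib

/-!
# Hallgren 2005 / class numbers under GRH — step Q3 (model): the order of the subgroup of
# `(ℤ/N)^k` generated by given vectors, by Bezout elimination (Howell-style echelon form)

Topic `Literature/Computability/Cryptography`; proof companion of `HallgrenClassGroup.lean`
(named fact `Hallgren2005_classNumber_qsolvable_of_GRH`). This file DEFINES the classical
post-processing of the class-number algorithm as a mathematical function and PROVES it correct;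
the definitions are real (with bodies), there is no named fact.

After Kitaev's eigenvalue measurement the algorithm holds `T` characters `ψ_t` of the group
`G' ≤ Cl(−d)` generated by the chosen forms `g_1, …, g_k`, each as the exact vector
`(ψ_t(g_1), …, ψ_t(g_k)) ∈ ((1/N)ℤ/ℤ)^k ≅ (ℤ/N)^k`; when the `ψ_t` generate `Ĝ'` (probability
`≥ 1 − #{subgroups}/2^T`, `HallgrenClassGroupUniformGeneration.lean`) the order of the subgroup of
`(ℤ/N)^k` they generate is `|Ĝ'| = |G'|`, the number sought. Computing the order of a subgroup of
`(ℤ/N)^k` from generators is linear algebra over the ring `ℤ/N` (zero divisors!); we use the device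
of Howell's normal form (Howell 1986; Storjohann–Mulders 1998): eliminate the first coordinate by
unimodular Bezout transforms of pairs of rows, which leaves ONE row `p` with a non-zero first
coordinate; adjoin `q = ord(p₀) · p` (first coordinate `0`) to the other rows; then
`⟨rows⟩ = ⟨p⟩ + M'` with `⟨p⟩ ∩ M' = ⟨q⟩`, so `|⟨rows⟩| = (ord p / ord q) · |M'|`, and `M'` lives in
the last `k − 1` coordinates — recurse.

* `bezoutPair p r` — the transform `(p, r) ↦ (s p + t r, (b/g) p − (a/g) r)`, `a, b` the first
  coordinates (as integers in `[0, N)`), `g = gcd(a, b) = a s + b t`; `bezoutPair_fst_apply_zero`,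
  `bezoutPair_snd_apply_zero` (new first coordinates `g` and `0`), `closure_bezoutPair`
  (the generated subgroup is unchanged: the transform has determinant `−1`);
* `elimFold` — the pass over the rows, `elimFold_spec` (invariants); `complementRow p = ord(p₀) · p`,
  `zmultiples_inf_ker_eq` (`⟨p⟩ ∩ {v₀ = 0} = ⟨q⟩`); `tailHom`, `card_closure_map_tail`;
* `subgroupOrder k rows` — the algorithm — and `subgroupOrder_eq_card_closure` — **correctness**:
  `subgroupOrder k rows = |⟨rows⟩|`.

For the programmed version: `ord(v) = N / gcd(N, v)` for `v ∈ ℤ/N` (Mathlib `ZMod.addOrderOf_coe`),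
and `ord(p) = lcm_i ord(p_i)` for a vector.

## References

* J. A. Howell, *Spans in the module `(ℤ_m)^s`*, Linear Multilinear Algebra 19 (1986) 67–77 [folklore].
* A. Storjohann, T. Mulders, *Fast algorithms for linear algebra modulo `N`*, ESA 1998 [folklore].
* K. K. H. Cheung, M. Mosca, *Decomposing finite abelian groups*, QIC 1 (2001), §3 [CheungMosca2001].
* A. M. Childs, W. van Dam, Rev. Mod. Phys. 82 (2010), §5.7 [ChildsVandam2010].
-/

noncomputable section

namespace Literature.Computability.Cryptography.Hallgren2005

namespace SubgroupOrder

open AddSubgroup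

variable {N : ℕ} [NeZero N] {k : ℕ}

/-! ### The Bezout transform of two rows -/

/-- **The Bezout transform** of the rows `p, r ∈ (ℤ/N)^{k+1}` at the first coordinate: with
`a = p₀`, `b = r₀` read as integers in `[0, N)`, `g = gcd(a, b) = a s + b t` (`s = gcdA`, `t = gcdB`),
the new rows are `p' = s p + t r` (first coordinate `g`) and `r' = (b/g) p − (a/g) r` (first
coordinate `0`). [cite: CheungMosca2001, §3 (linear algebra over Z_N on the sampled characters)] -/
def bezoutPair (p r : Fin (k + 1) → ZMod N) : (Fin (k + 1) → ZMod N) × (Fin (k + 1) → ZMod N) :=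
  (Nat.gcdA (p 0).val (r 0).val • p + Nat.gcdB (p 0).val (r 0).val • r,
    (((r 0).val / Nat.gcd (p 0).val (r 0).val : ℕ) : ℤ) • p -
      (((p 0).val / Nat.gcd (p 0).val (r 0).val : ℕ) : ℤ) • r)

/-- The first coordinate of `p' = s p + t r` is `gcd(p₀, r₀)`. [folklore] -/
theorem bezoutPair_fst_apply_zero (p r : Fin (k + 1) → ZMod N) :
    (bezoutPair p r).1 0 = (Nat.gcd (p 0).val (r 0).val : ZMod N) := by
  set a := (p 0).val with ha
  set b := (r 0).val with hb
  have key : ((Nat.gcd a b : ℕ) : ZMod N) =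
      (Nat.gcdA a b : ZMod N) * (a : ZMod N) + (Nat.gcdB a b : ZMod N) * (b : ZMod N) := by
    have := congrArg (fun z : ℤ => (z : ZMod N)) (Nat.gcd_eq_gcd_ab a b)
    push_cast at this
    rw [this]; ring
  have hpa : (a : ZMod N) = p 0 := by rw [ha]; exact ZMod.natCast_zmod_val (p 0)
  have hrb : (b : ZMod N) = r 0 := by rw [hb]; exact ZMod.natCast_zmod_val (r 0)
  rw [hpa, hrb] at key
  simp only [bezoutPair, Pi.add_apply, Pi.smul_apply]
  rw [zsmul_eq_mul, zsmul_eq_mul, ← ha, ← hb, key]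

/-- The first coordinate of `r' = (b/g) p − (a/g) r` is `0`. [folklore] -/
theorem bezoutPair_snd_apply_zero (p r : Fin (k + 1) → ZMod N) : (bezoutPair p r).2 0 = 0 := by
  set a := (p 0).val with ha
  set b := (r 0).val with hb
  set g := Nat.gcd a b with hg
  have ha' : a = g * (a / g) := (Nat.mul_div_cancel' (Nat.gcd_dvd_left a b)).symm
  have hb' : b = g * (b / g) := (Nat.mul_div_cancel' (Nat.gcd_dvd_right a b)).symm
  have h1 : (b / g) * a = (a / g) * b := by
    calc (b / g) * a = (b / g) * (g * (a / g)) := by rw [← ha']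
      _ = (g * (b / g)) * (a / g) := by ring
      _ = b * (a / g) := by rw [← hb']
      _ = (a / g) * b := by ring
  have h1' : ((b / g : ℕ) : ZMod N) * (a : ZMod N) = ((a / g : ℕ) : ZMod N) * (b : ZMod N) := by
    exact_mod_cast congrArg (fun n : ℕ => (n : ZMod N)) h1
  have hpa : (a : ZMod N) = p 0 := by rw [ha]; exact ZMod.natCast_zmod_val (p 0)
  have hrb : (b : ZMod N) = r 0 := by rw [hb]; exact ZMod.natCast_zmod_val (r 0)
  rw [hpa, hrb] at h1'
  simp only [bezoutPair, Pi.sub_apply, Pi.smul_apply]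
  rw [zsmul_eq_mul, zsmul_eq_mul, Int.cast_natCast, Int.cast_natCast, ← ha, ← hb, ← hg, h1', sub_self]

/-- The Bezout coefficients satisfy `(a/g) s + (b/g) t = 1` when `a ≠ 0`. [folklore] -/
theorem bezout_coeff_eq_one {a b : ℕ} (ha : a ≠ 0) :
    ((a / Nat.gcd a b : ℕ) : ℤ) * Nat.gcdA a b + ((b / Nat.gcd a b : ℕ) : ℤ) * Nat.gcdB a b = 1 := by
  set g := Nat.gcd a b with hg
  have hg0 : (g : ℤ) ≠ 0 := by exact_mod_cast (Nat.gcd_pos_of_pos_left b (Nat.pos_of_ne_zero ha)).ne'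
  have hga : ((a / g : ℕ) : ℤ) * g = a := by exact_mod_cast Nat.div_mul_cancel (Nat.gcd_dvd_left a b)
  have hgb : ((b / g : ℕ) : ℤ) * g = b := by exact_mod_cast Nat.div_mul_cancel (Nat.gcd_dvd_right a b)
  have hbez : (g : ℤ) = a * Nat.gcdA a b + b * Nat.gcdB a b := Nat.gcd_eq_gcd_ab a b
  apply mul_right_cancel₀ hg0
  rw [one_mul]
  calc (((a / g : ℕ) : ℤ) * Nat.gcdA a b + ((b / g : ℕ) : ℤ) * Nat.gcdB a b) * g
      = ((a / g : ℕ) : ℤ) * g * Nat.gcdA a b + ((b / g : ℕ) : ℤ) * g * Nat.gcdB a b := by ring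
    _ = a * Nat.gcdA a b + b * Nat.gcdB a b := by rw [hga, hgb]
    _ = g := hbez.symm

omit [NeZero N] in
/-- **The Bezout transform does not change the generated subgroup** (together with any further
generators `S`): `p', r' ∈ ⟨p, r⟩` trivially, and conversely `p = (a/g) p' + t r'`, `r = (b/g) p' − s r'`
(the transform has determinant `−((a/g) s + (b/g) t) = −1`); requires `p₀ ≠ 0`. [folklore] -/
theorem closure_bezoutPair (p r : Fin (k + 1) → ZMod N) (hp : p 0 ≠ 0)
    (S : Set (Fin (k + 1) → ZMod N)) :
    closure (insert (bezoutPair p r).1 (insert (bezoutPair p r).2 S)) = closure (insert p (insert r S)) := by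
  set a := (p 0).val with ha
  set b := (r 0).val with hb
  set g := Nat.gcd a b with hg
  set s := Nat.gcdA a b with hs
  set t := Nat.gcdB a b with ht
  have ha0 : a ≠ 0 := by
    rw [ha]; exact fun h => hp ((ZMod.val_eq_zero _).mp h)
  have hcoef : ((a / g : ℕ) : ℤ) * s + ((b / g : ℕ) : ℤ) * t = 1 := bezout_coeff_eq_one ha0
  have hp' : (bezoutPair p r).1 = s • p + t • r := rfl
  have hr' : (bezoutPair p r).2 = ((b / g : ℕ) : ℤ) • p - ((a / g : ℕ) : ℤ) • r := rfl
  apply le_antisymm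
  · refine (closure_le _).mpr ?_
    intro v hv
    rcases hv with rfl | rfl | hv
    · rw [hp']
      refine add_mem (zsmul_mem (subset_closure (Set.mem_insert _ _)) _)
        (zsmul_mem (subset_closure (Set.mem_insert_of_mem _ (Set.mem_insert _ _))) _)
    · rw [hr']
      refine sub_mem (zsmul_mem (subset_closure (Set.mem_insert _ _)) _)
        (zsmul_mem (subset_closure (Set.mem_insert_of_mem _ (Set.mem_insert _ _))) _)
    · exact subset_closure (Set.mem_insert_of_mem _ (Set.mem_insert_of_mem _ hv))
  · have hcZ : ((a / g : ℕ) : ZMod N) * (s : ZMod N) + ((b / g : ℕ) : ZMod N) * (t : ZMod N) = 1 := by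
      have := congrArg (fun z : ℤ => (z : ZMod N)) hcoef
      simp only [Int.cast_add, Int.cast_mul, Int.cast_one, Int.cast_natCast] at this
      exact this
    have h1 : (bezoutPair p r).1 ∈ closure (insert (bezoutPair p r).1 (insert (bezoutPair p r).2 S)) :=
      subset_closure (Set.mem_insert _ _)
    have h2 : (bezoutPair p r).2 ∈ closure (insert (bezoutPair p r).1 (insert (bezoutPair p r).2 S)) :=
      subset_closure (Set.mem_insert_of_mem _ (Set.mem_insert _ _))
    -- `p = (a/g) p' + t r'` and `r = (b/g) p' − s r'`
    have hpe : p = ((a / g : ℕ) : ℤ) • (bezoutPair p r).1 + t • (bezoutPair p r).2 := by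
      rw [hp', hr']
      funext i
      simp only [Pi.add_apply, Pi.smul_apply, Pi.sub_apply]
      simp only [zsmul_eq_mul, Int.cast_natCast]
      linear_combination (-(p i)) * hcZ
    have hre : r = ((b / g : ℕ) : ℤ) • (bezoutPair p r).1 - s • (bezoutPair p r).2 := by
      rw [hp', hr']
      funext i
      simp only [Pi.add_apply, Pi.smul_apply, Pi.sub_apply]
      simp only [zsmul_eq_mul, Int.cast_natCast]
      linear_combination (-(r i)) * hcZ
    have hpmem : p ∈ closure (insert (bezoutPair p r).1 (insert (bezoutPair p r).2 S)) := by
      have := add_mem (zsmul_mem h1 ((a / g : ℕ) : ℤ)) (zsmul_mem h2 t)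
      rwa [← hpe] at this
    have hrmem : r ∈ closure (insert (bezoutPair p r).1 (insert (bezoutPair p r).2 S)) := by
      have := sub_mem (zsmul_mem h1 ((b / g : ℕ) : ℤ)) (zsmul_mem h2 s)
      rwa [← hre] at this
    refine (closure_le _).mpr ?_
    intro v hv
    rcases hv with hvp | hvr | hv
    · rw [hvp]; exact hpmem
    · rw [hvr]; exact hrmem
    · exact subset_closure (Set.mem_insert_of_mem _ (Set.mem_insert_of_mem _ hv))

/-! ### The elimination pass -/

/-- **The elimination pass** over the rows `rs`, carrying an optional pivot (a row with non-zero
first coordinate) and the rows already reduced to first coordinate `0`: a row with first coordinate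
`0` is moved to the reduced rows; the first other row becomes the pivot; every further row is
combined with the pivot by `bezoutPair`. [cite: CheungMosca2001, §3 (linear algebra over Z_N on the sampled characters)] -/
def elimFold : Option (Fin (k + 1) → ZMod N) → List (Fin (k + 1) → ZMod N) →
    List (Fin (k + 1) → ZMod N) → Option (Fin (k + 1) → ZMod N) × List (Fin (k + 1) → ZMod N)
  | p?, rest, [] => (p?, rest)
  | none, rest, r :: rs => if r 0 = 0 then elimFold none (r :: rest) rs else elimFold (some r) rest rs
  | some p, rest, r :: rs => elimFold (some (bezoutPair p r).1) ((bezoutPair p r).2 :: rest) rs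

omit [NeZero N] in
/-- The generators carried by a state of the pass: the pivot (if any), the reduced rows and the
rows still to be processed. [folklore] -/
theorem mem_stateSet_iff (p? : Option (Fin (k + 1) → ZMod N)) (rest rs : List (Fin (k + 1) → ZMod N))
    (v : Fin (k + 1) → ZMod N) :
    v ∈ {w | w ∈ p?.toList ++ rest ++ rs} ↔ (p? = some v ∨ v ∈ rest ∨ v ∈ rs) := by
  cases p? <;> simp [eq_comm]

/-- **Invariants of the elimination pass.** If the reduced rows have first coordinate `0` and the
pivot (if any) has non-zero first coordinate, then after the pass: the generated subgroup is the
same, all reduced rows have first coordinate `0`, and the pivot (if any) has non-zero first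
coordinate. [folklore] -/
theorem elimFold_spec : ∀ (rs : List (Fin (k + 1) → ZMod N)) (p? : Option (Fin (k + 1) → ZMod N))
    (rest : List (Fin (k + 1) → ZMod N)),
    (∀ v ∈ rest, v 0 = 0) → (∀ p, p? = some p → p 0 ≠ 0) →
      closure {w | w ∈ (elimFold p? rest rs).1.toList ++ (elimFold p? rest rs).2} =
          closure {w | w ∈ p?.toList ++ rest ++ rs} ∧
        (∀ v ∈ (elimFold p? rest rs).2, v 0 = 0) ∧
        (∀ p, (elimFold p? rest rs).1 = some p → p 0 ≠ 0)
  | [], p?, rest, hrest, hpiv => by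
    refine ⟨by simp [elimFold], by simpa [elimFold] using hrest, by simpa [elimFold] using hpiv⟩
  | r :: rs, none, rest, hrest, _ => by
    by_cases hr0 : r 0 = 0
    · have ih := elimFold_spec rs none (r :: rest)
        (fun v hv => by
          rcases List.mem_cons.mp hv with rfl | hv
          · exact hr0
          · exact hrest v hv)
        (fun p hp => by simp at hp)
      simp only [elimFold, if_pos hr0]
      refine ⟨ih.1.trans ?_, ih.2.1, ih.2.2⟩
      congr 1
      ext w
      simp [or_comm, or_assoc]
    · have ih := elimFold_spec rs (some r) rest hrest (fun p hp => by
        simp only [Option.some.injEq] at hp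
        rw [← hp]; exact hr0)
      simp only [elimFold, if_neg hr0]
      refine ⟨ih.1.trans ?_, ih.2.1, ih.2.2⟩
      congr 1
      ext w
      simp [or_comm, or_assoc]
  | r :: rs, some p, rest, hrest, hpiv => by
    have hp0 : p 0 ≠ 0 := hpiv p rfl
    have hg0 : (bezoutPair p r).1 0 ≠ 0 := by
      rw [bezoutPair_fst_apply_zero]
      have ha0 : (p 0).val ≠ 0 := fun h => hp0 ((ZMod.val_eq_zero _).mp h)
      have hgpos : 0 < Nat.gcd (p 0).val (r 0).val := Nat.gcd_pos_of_pos_left _ (Nat.pos_of_ne_zero ha0)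
      have hglt : Nat.gcd (p 0).val (r 0).val < N :=
        lt_of_le_of_lt (Nat.gcd_le_left _ (Nat.pos_of_ne_zero ha0)) (ZMod.val_lt (p 0))
      intro h
      rw [ZMod.natCast_eq_zero_iff] at h
      exact absurd (Nat.le_of_dvd hgpos h) (not_le.mpr hglt)
    have ih := elimFold_spec rs (some (bezoutPair p r).1) ((bezoutPair p r).2 :: rest)
      (fun v hv => by
        rcases List.mem_cons.mp hv with rfl | hv
        · exact bezoutPair_snd_apply_zero p r
        · exact hrest v hv)
      (fun p' hp' => by
        simp only [Option.some.injEq] at hp'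
        rw [← hp']; exact hg0)
    simp only [elimFold]
    refine ⟨ih.1.trans ?_, ih.2.1, ih.2.2⟩
    -- the generated subgroup: `closure_bezoutPair`
    have hset1 : {w | w ∈ (some (bezoutPair p r).1).toList ++ ((bezoutPair p r).2 :: rest) ++ rs} =
        insert (bezoutPair p r).1 (insert (bezoutPair p r).2 {w | w ∈ rest ++ rs}) := by
      ext w; simp
    have hset2 : {w | w ∈ (some p).toList ++ rest ++ (r :: rs)} =
        insert p (insert r {w | w ∈ rest ++ rs}) := by
      ext w; simp [or_left_comm]
    rw [hset1, hset2, closure_bezoutPair p r hp0]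

/-! ### The complement row and the kernel of the first coordinate -/

/-- The subgroup of vectors with first coordinate `0` (kernel of the first projection). [folklore] -/
def kerZero (N k : ℕ) [NeZero N] : AddSubgroup (Fin (k + 1) → ZMod N) :=
  (Pi.evalAddMonoidHom (fun _ : Fin (k + 1) => ZMod N) 0).ker

/-- Membership in `kerZero`. [folklore] -/
@[simp] theorem mem_kerZero (v : Fin (k + 1) → ZMod N) : v ∈ kerZero N k ↔ v 0 = 0 := Iff.rfl

/-- **The complement row** `q = ord(p₀) · p` of a pivot `p`: the generator of `⟨p⟩ ∩ {v₀ = 0}`.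
(Programmed form: `ord(p₀) = N / gcd(N, p₀)`, Mathlib `ZMod.addOrderOf_coe`.) [folklore] -/
def complementRow (p : Fin (k + 1) → ZMod N) : Fin (k + 1) → ZMod N := addOrderOf (p 0) • p

omit [NeZero N] in
/-- The complement row has first coordinate `0`. [folklore] -/
theorem complementRow_apply_zero (p : Fin (k + 1) → ZMod N) : complementRow p 0 = 0 := by
  rw [complementRow, Pi.smul_apply, addOrderOf_nsmul_eq_zero]

/-- **`⟨p⟩ ∩ {v₀ = 0} = ⟨q⟩`**: a multiple `j p` has first coordinate `0` iff `ord(p₀) ∣ j` iff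
`j p` is a multiple of `q = ord(p₀) p`. [folklore] -/
theorem zmultiples_inf_kerZero_eq (p : Fin (k + 1) → ZMod N) :
    AddSubgroup.zmultiples p ⊓ kerZero N k = AddSubgroup.zmultiples (complementRow p) := by
  apply le_antisymm
  · intro v hv
    obtain ⟨hv1, hv0⟩ := AddSubgroup.mem_inf.mp hv
    obtain ⟨j, rfl⟩ := AddSubgroup.mem_zmultiples_iff.mp hv1
    rw [mem_kerZero, Pi.smul_apply] at hv0
    obtain ⟨m, rfl⟩ := (addOrderOf_dvd_iff_zsmul_eq_zero.mpr hv0)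
    refine AddSubgroup.mem_zmultiples_iff.mpr ⟨m, ?_⟩
    rw [complementRow, mul_comm, mul_zsmul, natCast_zsmul]
  · rw [AddSubgroup.zmultiples_le]
    refine ⟨?_, ?_⟩
    · rw [complementRow, ← natCast_zsmul]
      exact zsmul_mem (AddSubgroup.mem_zmultiples p) _
    · exact complementRow_apply_zero p

/-! ### Passing to the last `k` coordinates -/

/-- Dropping the first coordinate, as a homomorphism `(ℤ/N)^{k+1} → (ℤ/N)^k`. [folklore] -/
def tailHom (N k : ℕ) [NeZero N] : (Fin (k + 1) → ZMod N) →+ (Fin k → ZMod N) where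
  toFun v := Fin.tail v
  map_zero' := rfl
  map_add' _ _ := rfl

/-- `tailHom` is injective on vectors with first coordinate `0`. [folklore] -/
theorem tailHom_injOn : Set.InjOn (tailHom N k) (kerZero N k : Set (Fin (k + 1) → ZMod N)) := by
  intro v hv w hw h
  rw [SetLike.mem_coe, mem_kerZero] at hv hw
  rw [← Fin.cons_self_tail v, ← Fin.cons_self_tail w, hv, hw]
  exact congrArg (Fin.cons 0) h

/-- **Dropping the first coordinate preserves the order of a subgroup of `{v₀ = 0}`**:
for rows with first coordinate `0`, `|⟨rows⟩| = |⟨tails of rows⟩|`. [folklore] -/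
theorem card_closure_map_tail (L : List (Fin (k + 1) → ZMod N)) (hL : ∀ v ∈ L, v 0 = 0) :
    Nat.card (closure {w | w ∈ L.map Fin.tail}) = Nat.card (closure {v | v ∈ L}) := by
  have hle : closure {v | v ∈ L} ≤ kerZero N k := (closure_le _).mpr fun v hv => hL v hv
  have himage : {w | w ∈ L.map Fin.tail} = (tailHom N k) '' {v | v ∈ L} := by
    ext w
    simp only [Set.mem_setOf_eq, List.mem_map, Set.mem_image]
    constructor
    · rintro ⟨v, hv, rfl⟩; exact ⟨v, hv, rfl⟩
    · rintro ⟨v, hv, rfl⟩; exact ⟨v, hv, rfl⟩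
  rw [himage, ← AddMonoidHom.map_closure]
  have hcoe : ((AddSubgroup.map (tailHom N k) (closure {v | v ∈ L}) : AddSubgroup (Fin k → ZMod N)) :
      Set (Fin k → ZMod N)) = (tailHom N k) '' (closure {v | v ∈ L} : Set (Fin (k + 1) → ZMod N)) :=
    AddSubgroup.coe_map _ _
  rw [← SetLike.coe_sort_coe, hcoe, Nat.card_image_of_injOn (tailHom_injOn.mono hle)]
  rfl

/-! ### The algorithm and its correctness -/

/-- **The order of the subgroup of `(ℤ/N)^k` generated by `rows`** (the algorithm): eliminate the
first coordinate (`elimFold`); without a pivot recurse on the tails of the reduced rows; with a pivot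
`p`, multiply `ord p / ord q` (`q = complementRow p`) by the recursive value on the tails of `q` and
the reduced rows. [cite: CheungMosca2001, §3 (group structure from the sampled characters)] -/
def subgroupOrder : (k : ℕ) → List (Fin k → ZMod N) → ℕ
  | 0, _ => 1
  | k + 1, rows =>
    match (elimFold none [] rows).1 with
    | none => subgroupOrder k ((elimFold none [] rows).2.map Fin.tail)
    | some p => (addOrderOf p / addOrderOf (complementRow p)) *
        subgroupOrder k ((complementRow p :: (elimFold none [] rows).2).map Fin.tail)

/-- The subgroup generated by a pivot `p` and rows `R` with first coordinate `0`: with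
`P = ⟨p⟩`, `M' = ⟨q, R⟩`, one has `⟨p, R⟩ = P ⊔ M'` and `P ⊓ M' = ⟨q⟩`, hence
`|⟨p, R⟩| = (ord p / ord q) · |M'|`. [folklore] -/
theorem card_closure_pivot (p : Fin (k + 1) → ZMod N) (R : Set (Fin (k + 1) → ZMod N))
    (hR : ∀ v ∈ R, v 0 = 0) :
    Nat.card (closure (insert p R)) =
      (addOrderOf p / addOrderOf (complementRow p)) * Nat.card (closure (insert (complementRow p) R)) := by
  set q := complementRow p with hq
  set P : AddSubgroup (Fin (k + 1) → ZMod N) := AddSubgroup.zmultiples p with hP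
  set M' : AddSubgroup (Fin (k + 1) → ZMod N) := closure (insert q R) with hM'
  have hqP : q ∈ P := by
    rw [hq, complementRow, ← natCast_zsmul]
    exact zsmul_mem (AddSubgroup.mem_zmultiples p) _
  -- `⟨p, R⟩ = P ⊔ M'`
  have hsup : closure (insert p R) = P ⊔ M' := by
    apply le_antisymm
    · refine (closure_le _).mpr ?_
      rintro v (rfl | hv)
      · exact AddSubgroup.mem_sup_left (AddSubgroup.mem_zmultiples v)
      · exact AddSubgroup.mem_sup_right (subset_closure (Set.mem_insert_of_mem _ hv))
    · refine sup_le ?_ ?_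
      · rw [hP, AddSubgroup.zmultiples_le]
        exact subset_closure (Set.mem_insert _ _)
      · refine (closure_le _).mpr ?_
        rintro v (rfl | hv)
        · have : P ≤ closure (insert p R) := by
            rw [hP, AddSubgroup.zmultiples_le]; exact subset_closure (Set.mem_insert _ _)
          exact this hqP
        · exact subset_closure (Set.mem_insert_of_mem _ hv)
  -- `P ⊓ M' = ⟨q⟩`
  have hM'ker : M' ≤ kerZero N k := by
    refine (closure_le _).mpr ?_
    rintro v (rfl | hv)
    · exact complementRow_apply_zero p
    · exact hR v hv
  have hinf : M' ⊓ P = AddSubgroup.zmultiples q := by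
    apply le_antisymm
    · calc M' ⊓ P ≤ kerZero N k ⊓ P := inf_le_inf_right _ hM'ker
        _ = P ⊓ kerZero N k := inf_comm _ _
        _ = AddSubgroup.zmultiples q := zmultiples_inf_kerZero_eq p
    · rw [AddSubgroup.zmultiples_le]
      exact ⟨subset_closure (Set.mem_insert _ _), hqP⟩
  -- cardinalities through relative indices
  have h1 : Nat.card M' * M'.relIndex (P ⊔ M') = Nat.card ↥(P ⊔ M') := by
    have := AddSubgroup.relIndex_mul_relIndex ⊥ M' (P ⊔ M') bot_le le_sup_right
    rwa [AddSubgroup.relIndex_bot_left, AddSubgroup.relIndex_bot_left] at this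
  have h2 : M'.relIndex (P ⊔ M') = M'.relIndex P := AddSubgroup.relIndex_sup_right P M'
  have h3 : Nat.card ↥(M' ⊓ P) * M'.relIndex P = Nat.card P := by
    have := AddSubgroup.relIndex_mul_relIndex ⊥ (M' ⊓ P) P bot_le inf_le_right
    rwa [AddSubgroup.relIndex_bot_left, AddSubgroup.relIndex_bot_left, AddSubgroup.inf_relIndex_right] at this
  rw [hinf, Nat.card_zmultiples] at h3
  rw [hP, Nat.card_zmultiples, ← hP] at h3
  have hq0 : 0 < addOrderOf q := addOrderOf_pos q
  have hrel : M'.relIndex P = addOrderOf p / addOrderOf q := by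
    rw [← h3, Nat.mul_div_cancel_left _ hq0]
  rw [hsup, ← h1, h2, hrel, mul_comm]

/-- **Correctness of `subgroupOrder`**: for every list of vectors of `(ℤ/N)^k`,
`subgroupOrder k rows` is the order of the subgroup they generate. [cite: CheungMosca2001, §3 (group structure from the sampled characters)] -/
theorem subgroupOrder_eq_card_closure : ∀ (k : ℕ) (rows : List (Fin k → ZMod N)),
    subgroupOrder k rows = Nat.card (closure {v | v ∈ rows})
  | 0, rows => by
    rw [subgroupOrder]
    haveI : Subsingleton (Fin 0 → ZMod N) := inferInstance
    have : closure {v : Fin 0 → ZMod N | v ∈ rows} = ⊤ := Subsingleton.elim _ _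
    rw [this, AddSubgroup.card_top, Nat.card_unique]
  | k + 1, rows => by
    obtain ⟨hcl, hrest, -⟩ := elimFold_spec rows none [] (fun v hv => by simp at hv) (fun p hp => by simp at hp)
    have hrows : {w | w ∈ (none : Option (Fin (k + 1) → ZMod N)).toList ++ [] ++ rows} =
        {v | v ∈ rows} := by
      ext w; simp
    rw [hrows] at hcl
    rw [← hcl, subgroupOrder]
    rcases hE : (elimFold none [] rows).1 with _ | p
    · -- no pivot: all rows reduce to first coordinate `0`
      simp only
      rw [subgroupOrder_eq_card_closure k, card_closure_map_tail _ hrest]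
      have hset : {w | w ∈ (none : Option (Fin (k + 1) → ZMod N)).toList ++ (elimFold none [] rows).2} =
          {v | v ∈ (elimFold none [] rows).2} := by
        ext w; simp
      rw [hset]
    · simp only
      rw [subgroupOrder_eq_card_closure k, card_closure_map_tail _ (fun v hv => by
          rcases List.mem_cons.mp hv with rfl | hv
          · exact complementRow_apply_zero p
          · exact hrest v hv)]
      have hset1 : {v | v ∈ complementRow p :: (elimFold none [] rows).2} =
          insert (complementRow p) {v | v ∈ (elimFold none [] rows).2} := by
        ext w; simp
      have hset2 : {w | w ∈ (some p).toList ++ (elimFold none [] rows).2} =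
          insert p {v | v ∈ (elimFold none [] rows).2} := by
        ext w; simp
      rw [hset1, hset2, card_closure_pivot p {v | v ∈ (elimFold none [] rows).2} hrest]

end SubgroupOrder

end Literature.Computability.Cryptography.Hallgren2005

end
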